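import Literature.Analysis.FluidPDE.TypeIAncientMildClassical
import Literature.Analysis.FluidPDE.KNSSSmoothingHolds
import Literature.Analysis.FluidPDE.KNSSTypeIRateLiouvilleMild
import Literature.Analysis.FluidPDE.PineauVicolRSSChaeWolf
import HarnessLib

/-!
# Crux `HubbleDynamo.NoSelfExcitedDynamo` (stmt-NavierStokesRegularity-1934), line `registered`:
# stub `stub_classicalOfOseen` — a continuous bounded Oseen-mild ancient field is classical

Helper file (`--supports stmt-NavierStokesRegularity-1934`; theorems only, sorry-free). Let
`v : ℝ → ℝ³ → ℝ³` be continuous on the open past `(−∞, 0) × ℝ³`, bounded (`‖v(t, x)‖ ≤ M`), with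
weakly divergence-free slices, and a pointwise solution of the Oseen integral equation
`v(t) = e^{(t−s)Δ} v(s) − B¹ₛ(v, v)(t)` for all `s < t < 0` (`oseenDuhamel 1 s v v t`, the
bilinear Duhamel term of Koch–Nadirashvili–Seregin–Šverák 2009, §4). Then `v` **itself** (not a
modification) is the velocity of a classical solution of the unforced Navier–Stokes system with
unit viscosity on `(−∞, 0)`, for one jointly smooth pressure:
`∃ p, IsClassicalNSSolutionOn (Iio 0) 1 0 v p`.

Proof (all ingredients are proved in the tree).
1. *Joint smoothness on every window `(s, 0)`.* KNSS 2009, Prop. 4.1 (`knss2009_smoothing_holds`,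
   with `ν = 1`, datum `a = v(s)`, `T₁ = 0`): the right-hand side
   `(t, x) ↦ e^{(t−s)Δ}v(s)(x) − B¹ₛ(v, v)(t)(x)` of the Oseen equation is jointly `C^∞` on
   `(s, 0) × ℝ³`; by the Oseen identity it *equals* `v` there, so `v` is jointly smooth on every
   window (`classicalOseen_isSmoothSpaceTimeOn_Ioo`).
2. *Pressure on every window `(t₀, 0)`.* Oseen-mild + continuous + bounded + weakly
   divergence-free slices ⇒ bounded ancient mild solution in the duality form
   (`isBoundedAncientMildSolution_of_oseen`), whose translate `v(· + t₀)` is a duality-form mild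
   solution on `(0, −t₀)` from the bounded datum `v(t₀)`
   (`IsAncientMildSolution.isMildNSSolutionOn_translate`); Fabes–Jones–Rivière's theorem for
   smooth bounded mild solutions (`classical_of_smooth_isMildNSSolutionOn_holds`) gives a smooth
   pressure on `(0, −t₀)`; translate back (`IsClassicalNSSolutionOn.comp_add_right`), exactly as in
   `IsTypeIAncientMild.exists_isClassicalNSSolutionOn_Ioo`
   (`classicalOseen_exists_isClassicalNSSolutionOn_Ioo`).
3. *One pressure on `(−∞, 0)`.* Patch the window pressures on the exhaustion `(−(k+1), 0)`
   (`IsClassicalNSSolutionOn.exists_pressure_Iio_of_Ioo`).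

## References

* G. Koch, N. Nadirashvili, G. Seregin, V. Šverák, *Liouville theorems for the Navier–Stokes
  equations and applications*, Acta Math. 203 (2009) 83–105 = arXiv:0709.3599, §4 (i) and
  Prop. 4.1. [KochNadirashviliSereginSverak2009]
* E. B. Fabes, B. F. Jones, N. M. Rivière, Arch. Rational Mech. Anal. 45 (1972) 222–240,
  Thm. 2.1. [FabesJonesRiviere1972]
-/

noncomputable section

-- the registered stub namespace repeats the summit name `NavierStokesRegularity` (summit = problem)
set_option linter.dupNamespace false

namespace Summit.NavierStokesRegularity.NavierStokesRegularity.Theorems.NoSelfExcitedDynamo.Registered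

open Set MeasureTheory Filter Topology Function
open scoped ENNReal ContDiff
open Literature.Analysis
open Literature.Analysis.FluidPDE

/-- **Joint smoothness on every window** (KNSS 2009, Prop. 4.1). If `v` is continuous on
`(−∞, 0) × ℝ³`, bounded by `M`, and solves the Oseen integral equation pointwise between all
`s < t < 0`, then `v` is jointly `C^∞` on `(s, 0) × ℝ³` for every `s < 0`: the right-hand side of
the Oseen equation from the datum `v(s)` is jointly smooth there (`knss2009_smoothing_holds`) and
equals `v`. -/
theorem classicalOseen_isSmoothSpaceTimeOn_Ioo
    {v : ℝ → EuclideanSpace ℝ (Fin 3) → EuclideanSpace ℝ (Fin 3)}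
    (hcont : ContinuousOn (uncurry v) (Iio 0 ×ˢ univ))
    {M : ℝ} (hM : ∀ t < 0, ∀ x, ‖v t x‖ ≤ M)
    (hmild : ∀ s t : ℝ, s < t → t < 0 → ∀ x,
      v t x = UnboundedOperators.heatExtension (v s) (t - s) x - oseenDuhamel 1 s v v t x)
    {s : ℝ} (hs : s < 0) :
    IsSmoothSpaceTimeOn (Ioo s 0) v := by
  have hM0 : 0 ≤ M := (norm_nonneg _).trans (hM (-1) (by norm_num) 0)
  have hvc : ∀ τ < 0, Continuous (v τ) := fun τ hτ =>
    hcont.comp_continuous (f := fun x : EuclideanSpace ℝ (Fin 3) => (τ, x)) (by fun_prop)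
      fun x => ⟨hτ, mem_univ _⟩
  have hbd : ∀ τ < 0, eLpNorm (v τ) ∞ volume ≤ ENNReal.ofReal M := fun τ hτ => by
    rw [eLpNorm_exponent_top]
    exact eLpNormEssSup_le_of_ae_bound (Eventually.of_forall fun x => hM τ hτ x)
  have hmeas : AEStronglyMeasurable (uncurry v)
      ((volume : Measure (ℝ × EuclideanSpace ℝ (Fin 3))).restrict (Ioo s 0 ×ˢ univ)) := by
    refine (hcont.mono ?_).aestronglyMeasurable (measurableSet_Ioo.prod MeasurableSet.univ)
    exact prod_mono (fun τ hτ => hτ.2) subset_rfl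
  have hid : ∀ t ∈ Ioo s 0, v t =ᵐ[volume] fun x =>
      UnboundedOperators.heatExtension (v s) (1 * (t - s)) x - oseenDuhamel 1 s v v t x := by
    intro t ht
    refine Eventually.of_forall fun x => ?_
    rw [one_mul]
    exact hmild s t ht.1 ht.2 x
  obtain ⟨hsm, -, -⟩ := knss2009_smoothing_holds (EuclideanSpace ℝ (Fin 3)) one_pos hs hM0
    (hvc s hs).aestronglyMeasurable (hbd s hs) hmeas (fun t ht => hbd t ht.2) hid
  refine hsm.congr fun z hz => ?_
  obtain ⟨t, x⟩ := z
  have ht : t ∈ Ioo s 0 := (mem_prod.1 hz).1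
  simp only [uncurry_apply_pair]
  rw [one_mul]
  exact hmild s t ht.1 ht.2 x

/-- **A pressure on every window `(t₀, 0)`** (KNSS 2009, §4 (i) + Fabes–Jones–Rivière 1972,
Thm. 2.1). Under the hypotheses of the stub, for every `t₀ < 0` the field `v` itself is the
velocity of a classical unforced Navier–Stokes solution (`ν = 1`) on `(t₀, 0)` for some smooth
pressure: Oseen-mild ⇒ duality-form bounded ancient mild (`isBoundedAncientMildSolution_of_oseen`),
the translate `v(· + t₀)` is a smooth bounded duality-form mild solution on `(0, −t₀)` from the
bounded datum `v(t₀)`, hence classical (`classical_of_smooth_isMildNSSolutionOn_holds`); translate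
back. -/
theorem classicalOseen_exists_isClassicalNSSolutionOn_Ioo
    {v : ℝ → EuclideanSpace ℝ (Fin 3) → EuclideanSpace ℝ (Fin 3)}
    (hcont : ContinuousOn (uncurry v) (Iio 0 ×ˢ univ))
    {M : ℝ} (hM : ∀ t < 0, ∀ x, ‖v t x‖ ≤ M)
    (hdiv : ∀ t < 0, IsWeaklyDivFree (v t))
    (hmild : ∀ s t : ℝ, s < t → t < 0 → ∀ x,
      v t x = UnboundedOperators.heatExtension (v s) (t - s) x - oseenDuhamel 1 s v v t x)
    {t₀ : ℝ} (ht₀ : t₀ < 0) :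
    ∃ p : ℝ → EuclideanSpace ℝ (Fin 3) → ℝ, IsClassicalNSSolutionOn (Ioo t₀ 0) 1 0 v p := by
  have hT : 0 < -t₀ := neg_pos.2 ht₀
  -- Oseen-mild ⇒ bounded ancient mild solution in the duality form
  have hanc : IsBoundedAncientMildSolution 1 v :=
    isBoundedAncientMildSolution_of_oseen one_pos hcont ⟨M, hM⟩ hdiv
      (fun s t hst ht x => by rw [one_mul]; exact hmild s t hst ht x)
  set w : ℝ → EuclideanSpace ℝ (Fin 3) → EuclideanSpace ℝ (Fin 3) := fun t => v (t + t₀) with hw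
  -- mild solution in duality form from the datum `v t₀` on `(0, -t₀)`
  have hmildOn : IsMildNSSolutionOn (Ioo 0 (-t₀)) 1 0 (v t₀) w :=
    (hanc.isAncientMildSolution.isMildNSSolutionOn_translate t₀).mono Ioo_subset_Ico_self
  -- joint smoothness of the translate
  have hsmw : IsSmoothSpaceTimeOn (Ioo 0 (-t₀)) w := by
    refine ((classicalOseen_isSmoothSpaceTimeOn_Ioo hcont hM hmild ht₀).comp_add_right t₀).mono
      fun t ht => ?_
    simp only [mem_preimage, mem_Ioo]
    exact ⟨by linarith [ht.1], by linarith [ht.2]⟩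
  -- uniform bound
  have hbdd : ∀ T₁ ∈ Ioo 0 (-t₀), ∃ K : ℝ≥0∞, K < ⊤ ∧
      ∀ t ∈ Ioo 0 T₁, eLpNorm (w t) ∞ volume ≤ K := by
    intro T₁ hT₁
    refine ⟨ENNReal.ofReal M, ENNReal.ofReal_lt_top, fun t ht => ?_⟩
    rw [eLpNorm_exponent_top]
    exact eLpNormEssSup_le_of_ae_bound
      (Eventually.of_forall fun x => hM (t + t₀) (by linarith [ht.2, hT₁.2]) x)
  -- the datum: measurable and integrable against Gaussians (bounded)
  have hvc : ∀ τ < 0, Continuous (v τ) := fun τ hτ =>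
    hcont.comp_continuous (f := fun x : EuclideanSpace ℝ (Fin 3) => (τ, x)) (by fun_prop)
      fun x => ⟨hτ, mem_univ _⟩
  have hu₀m : AEStronglyMeasurable (v t₀) volume := (hvc t₀ ht₀).aestronglyMeasurable
  have hu₀G : ∀ a : ℝ, 0 < a →
      Integrable (fun y => UnboundedOperators.heatKernel a y * ‖v t₀ y‖) volume := by
    intro a ha
    have hK : Integrable (UnboundedOperators.heatKernel (E := EuclideanSpace ℝ (Fin 3)) a) volume :=
      UnboundedOperators.integrable_heatKernel_holds ha
    have h := hK.bdd_mul (c := M) hu₀m.norm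
      (Eventually.of_forall fun y => by
        rw [norm_norm]; exact hM t₀ ht₀ y)
    refine h.congr (Eventually.of_forall fun y => ?_)
    simp only [mul_comm]
  obtain ⟨q, hcl⟩ := classical_of_smooth_isMildNSSolutionOn_holds (EuclideanSpace ℝ (Fin 3))
    one_pos hT hu₀m hu₀G hsmw hbdd hmildOn
  -- translate back to `(t₀, 0)`
  refine ⟨fun t => q (t - t₀), ?_⟩
  have h1 := hcl.comp_add_right (-t₀)
  have hset : (fun t : ℝ => t + -t₀) ⁻¹' Ioo 0 (-t₀) = Ioo t₀ 0 := by
    ext t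
    simp only [mem_preimage, mem_Ioo]
    constructor
    · rintro ⟨h1, h2⟩; exact ⟨by linarith, by linarith⟩
    · rintro ⟨h1, h2⟩; exact ⟨by linarith, by linarith⟩
  rw [hset] at h1
  have hf : (fun t : ℝ => (0 : ℝ → EuclideanSpace ℝ (Fin 3) → EuclideanSpace ℝ (Fin 3)) (t + -t₀)) =
      0 := by
    funext t; rfl
  have hu' : (fun t : ℝ => w (t + -t₀)) = v := by
    funext t; simp only [hw]; congr 1; ring
  have hp' : (fun t : ℝ => q (t + -t₀)) = fun t => q (t - t₀) := by
    funext t; rw [← sub_eq_add_neg]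
  rw [hf, hu', hp'] at h1
  exact h1

/-- **Stub `stub_classicalOfOseen`** (KNSS 2009, Prop. 4.1 + §4 (i); Fabes–Jones–Rivière 1972,
Thm. 2.1). A field `v` continuous on the open past `(−∞, 0) × ℝ³`, bounded, with weakly
divergence-free slices, solving the Oseen integral equation
`v(t) = e^{(t−s)Δ}v(s) − B¹ₛ(v, v)(t)` pointwise for all `s < t < 0`, is itself the velocity of a
classical unforced Navier–Stokes solution (`ν = 1`) on `(−∞, 0)` for one smooth pressure: a
pressure on every window `(−(k+1), 0)` (`classicalOseen_exists_isClassicalNSSolutionOn_Ioo`),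
patched to one pressure on `(−∞, 0)` (`IsClassicalNSSolutionOn.exists_pressure_Iio_of_Ioo`). -/
theorem stub_classicalOfOseen :
    ∀ v : ℝ → EuclideanSpace ℝ (Fin 3) → EuclideanSpace ℝ (Fin 3),
      ContinuousOn (Function.uncurry v) (Iio 0 ×ˢ univ) →
      (∃ M : ℝ, ∀ t < 0, ∀ x, ‖v t x‖ ≤ M) →
      (∀ t < 0, IsWeaklyDivFree (v t)) →
      (∀ s t : ℝ, s < t → t < 0 → ∀ x,
        v t x = Literature.Analysis.UnboundedOperators.heatExtension (v s) (t - s) x - oseenDuhamel 1 s v v t x) →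
      ∃ p : ℝ → EuclideanSpace ℝ (Fin 3) → ℝ, IsClassicalNSSolutionOn (Iio 0) 1 0 v p := by
  intro v hcont hbdd hdiv hmild
  obtain ⟨M, hM⟩ := hbdd
  have hwin : ∀ k : ℕ, ∃ p : ℝ → EuclideanSpace ℝ (Fin 3) → ℝ,
      IsClassicalNSSolutionOn (Ioo (-((k : ℝ) + 1)) 0) 1 0 v p := fun k =>
    classicalOseen_exists_isClassicalNSSolutionOn_Ioo hcont hM hdiv hmild
      (by have hk := k.cast_nonneg (α := ℝ); linarith)
  choose q hq using hwin
  refine IsClassicalNSSolutionOn.exists_pressure_Iio_of_Ioo (a := fun k : ℕ => -((k : ℝ) + 1)) hq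
    fun t ht => ?_
  obtain ⟨k, hk⟩ := exists_nat_gt (-t)
  exact ⟨k, by linarith⟩

end Summit.NavierStokesRegularity.NavierStokesRegularity.Theorems.NoSelfExcitedDynamo.Registered

end
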